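import Mathlib
import Summits.Ventures.HodgeRepro2.T5MuInvariantDVR

/-!
# T5ProfiniteDistribution — a bounded measure on a profinite space presented as an inverse limit
of finite sets IS a bounded compatible system on the finite levels: `W[[Γ]] = lim_k W[Γ/U_k]`
read in the model, for any `Γ` with a cofinal sequence of open subgroups

Tier-5 support for route-3's §G (route/T5-CHECK-G-p7.md §3 S1 / S2 / S4, §20.2 «what stays
prose: that the Katz branch measure is such an m»): in print the Katz / Hsieh measure
`ℒ⁻_{χ,Σ}` is an element of the completed group ring `W[[Γ⁻]] = lim_U W[Γ⁻/U]` over the open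
subgroups `U` of `Γ⁻ ≅ ℤ_p^δ` (S2), and its branch `L⁻_{Σ,λ⁻¹,𝔭}` of `W[[Γ_𝔭]] = lim_k W[Γ_𝔭/Γ_𝔭^{p^k}]`;
the kernel model (§55–§94) takes a measure to be a bounded linear functional on `C(Γ, W)`.
T5MeasureDistribution / T5DistributionMeasure gave the dictionary on `Γ_𝔭 ≅ ℤ_p` with the
residue classes `a + p^kℤ_p`.  This file gives it for ANY compact metric space `X` PRESENTED as
an inverse limit of finite sets (`Γ⁻ ≅ ℤ_p^δ` with the levels `(ℤ/p^k)^δ` included):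

* `Presentation X` — level maps `q k : X → F k` onto finite sets with open fibres, transition
  maps `res k : F (k+1) → F k` with `res k ∘ q (k+1) = q k`, and fibres that SHRINK (every `ε`
  is beaten by some level) — the data of `X ≅ lim_k F k`;
* the fibres are clopen, each is the disjoint union of the fibres of the next level over it
  (`indicatorCM_fiber_eq_sum`), and EVERY clopen set is a finite disjoint union of fibres of one
  level (`indicatorCM_eq_sum_fiber`: compactness — a thickening of the clopen set stays inside it);
* `coord m k a := m(1_{fiber k a})` — the coordinates of a measure in `lim_k A[F k]`: COMPATIBLE
  (`coord_compat`, the inverse-limit condition) and BOUNDED (`norm_coord_le`), packaged as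
  `toDistribution m : Distribution P A`;
* `eq_of_coord_eq` / `toDistribution_injective` — a bounded measure IS its system of coordinates;
* `muV_eq_iInf_coord` — the μ-invariant «inf over opens» of T5MuInvariantDVR is the infimum over
  the fibres of all levels, i.e. over the cosets of the cofinal subgroups `U_k` — Hsieh's
  «μ(φ) = inf_U v_p(φ(U))» with `U` running over the standard open subgroups.

The converse (every bounded compatible system is a measure: Riemann sums) is
T5ProfiniteDistributionMeasure; the presentations of `ℤ_p` and of `ℤ_p^ι` are
T5ProfiniteDistributionPadic.  No printed input is consumed.  §8(d): uses an L-value-free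
non-vanishing device: NO.
-/

namespace Summit.Ventures.HodgeRepro2.T5ProfiniteDistribution

open Summit.Ventures.HodgeRepro2.T5MeasureSupOnClopens (indicatorCM indicatorCM_apply
  norm_indicatorCM_le)
open Summit.Ventures.HodgeRepro2.T5MuInvariantDVR
open IsDiscreteValuationRing (addVal)
open Finset

universe u v

/-- A PRESENTATION of a metric space `X` as an inverse limit of finite sets
`F 0 ← F 1 ← F 2 ← ⋯` (in print: `Γ ≅ lim_k Γ/U_k` for a cofinal sequence of open subgroups
`U_k`): level maps `q k : X → F k` onto FINITE sets with OPEN fibres, transition maps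
`res k : F (k+1) → F k` compatible with the level maps, and fibres that SHRINK — for every
`ε > 0` some level has all its fibres of diameter `< ε`. -/
structure Presentation (X : Type u) [MetricSpace X] where
  /-- the finite set at level `k` (`Γ/U_k`). -/
  F : ℕ → Type v
  /-- finiteness of every level. -/
  fintype : ∀ k, Fintype (F k)
  /-- decidable equality on every level. -/
  decEq : ∀ k, DecidableEq (F k)
  /-- the level map (`Γ → Γ/U_k`). -/
  q : ∀ k, X → F k
  /-- the fibres of the level maps are open. -/
  isOpen_fiber : ∀ (k : ℕ) (a : F k), IsOpen {x | q k x = a}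
  /-- the transition map (`Γ/U_{k+1} → Γ/U_k`). -/
  res : ∀ k, F (k + 1) → F k
  /-- the level maps are compatible with the transition maps. -/
  res_q : ∀ (k : ℕ) (x : X), res k (q (k + 1) x) = q k x
  /-- the level maps are onto. -/
  surjective_q : ∀ k, Function.Surjective (q k)
  /-- the fibres shrink: every `ε > 0` is beaten by the fibres of some level. -/
  shrink : ∀ ε : ℝ, 0 < ε → ∃ k : ℕ, ∀ x y : X, q k x = q k y → dist x y < ε

namespace Presentation

variable {X : Type u} [MetricSpace X] (P : Presentation.{u, v} X)

/-- Every level is a finite type. -/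
instance instFintypeF (k : ℕ) : Fintype (P.F k) := P.fintype k

/-- Every level has decidable equality. -/
instance instDecidableEqF (k : ℕ) : DecidableEq (P.F k) := P.decEq k

section Fiber

/-- The fibre of the level map over `a : F k` (the coset of `U_k` attached to `a`). -/
def fiber (k : ℕ) (a : P.F k) : Set X := {x | P.q k x = a}

/-- `x ∈ P.fiber k a ↔ P.q k x = a`. -/
theorem mem_fiber_iff {k : ℕ} {a : P.F k} {x : X} : x ∈ P.fiber k a ↔ P.q k x = a := Iff.rfl

/-- `x` lies in its own fibre. -/
theorem mem_fiber_self (k : ℕ) (x : X) : x ∈ P.fiber k (P.q k x) := rfl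

/-- Fibres are open. -/
theorem isOpen_fiber' (k : ℕ) (a : P.F k) : IsOpen (P.fiber k a) := P.isOpen_fiber k a

/-- Fibres are closed: the complement is the union of the other fibres. -/
theorem isClosed_fiber (k : ℕ) (a : P.F k) : IsClosed (P.fiber k a) := by
  rw [← isOpen_compl_iff]
  have : (P.fiber k a)ᶜ = ⋃ b : P.F k, ⋃ (_ : b ≠ a), P.fiber k b := by
    ext x
    simp only [Set.mem_compl_iff, mem_fiber_iff, Set.mem_iUnion, exists_prop]
    exact ⟨fun h => ⟨P.q k x, h, rfl⟩, fun ⟨b, hb, hx⟩ => hx ▸ hb⟩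
  rw [this]
  exact isOpen_iUnion fun b => isOpen_iUnion fun _ => P.isOpen_fiber k b

/-- Fibres are clopen. -/
theorem isClopen_fiber (k : ℕ) (a : P.F k) : IsClopen (P.fiber k a) :=
  ⟨P.isClosed_fiber k a, P.isOpen_fiber' k a⟩

/-- A fibre of level `k + 1` lies in the fibre of level `k` over its transition image. -/
theorem fiber_succ_subset (k : ℕ) (b : P.F (k + 1)) : P.fiber (k + 1) b ⊆ P.fiber k (P.res k b) := by
  intro x hx
  rw [mem_fiber_iff] at hx ⊢
  rw [← hx, P.res_q]

/-- Points with the same level-`l` image have the same level-`k` image for `k ≤ l`. -/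
theorem q_eq_of_le {k l : ℕ} (h : k ≤ l) {x y : X} (hxy : P.q l x = P.q l y) : P.q k x = P.q k y := by
  induction l, h using Nat.le_induction with
  | base => exact hxy
  | succ l _ ih => exact ih (by rw [← P.res_q l x, ← P.res_q l y, hxy])

/-- The fibres of every level `≥ N` are `ε`-small, for some `N`. -/
theorem exists_forall_shrink {ε : ℝ} (hε : 0 < ε) :
    ∃ N : ℕ, ∀ k, N ≤ k → ∀ x y : X, P.q k x = P.q k y → dist x y < ε := by
  obtain ⟨N, hN⟩ := P.shrink ε hε
  exact ⟨N, fun k hk x y hxy => hN x y (P.q_eq_of_le hk hxy)⟩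

variable [CompactSpace X]

/-- COMPACTNESS: a clopen set contains every fibre (of a suitable level) of each of its points —
a thickening of the compact set `U` stays inside the open set `U`, and some level has fibres of
smaller diameter. -/
theorem exists_level_fiber_subset {U : Set X} (hU : IsClopen U) :
    ∃ K : ℕ, ∀ x ∈ U, P.fiber K (P.q K x) ⊆ U := by
  obtain ⟨δ, hδ, hthick⟩ :=
    IsCompact.exists_thickening_subset_open hU.1.isCompact hU.2 (subset_refl U)
  obtain ⟨K, hK⟩ := P.shrink δ hδ
  refine ⟨K, fun x hx y hy => hthick ?_⟩
  rw [Metric.mem_thickening_iff]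
  exact ⟨x, hx, hK y x hy⟩

end Fiber

section Indicator

variable {A : Type*} [NormedCommRing A]

/-- `x` lies in exactly one fibre of each level. -/
theorem indicator_fiber_of_ne {k : ℕ} {b : P.F k} {x : X} (h : P.q k x ≠ b) (f : X → A) :
    (P.fiber k b).indicator f x = 0 :=
  Set.indicator_of_notMem (show x ∉ P.fiber k b from h) f

/-- Pointwise form of the next-level decomposition of a fibre. -/
theorem indicator_fiber_eq_sum_succ (k : ℕ) (a : P.F k) (x : X) :
    (P.fiber k a).indicator (1 : X → A) x =
      ∑ b ∈ univ.filter (fun b : P.F (k + 1) => P.res k b = a),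
        (P.fiber (k + 1) b).indicator (1 : X → A) x := by
  by_cases h : P.q k x = a
  · rw [Set.indicator_of_mem (show x ∈ P.fiber k a from h),
      Finset.sum_eq_single_of_mem (P.q (k + 1) x)
        (Finset.mem_filter.2 ⟨Finset.mem_univ _, (P.res_q k x).trans h⟩)
        (fun b _ hb => P.indicator_fiber_of_ne (Ne.symm hb) _),
      Set.indicator_of_mem (P.mem_fiber_self (k + 1) x)]
  · rw [Set.indicator_of_notMem (show x ∉ P.fiber k a from h)]
    refine (Finset.sum_eq_zero fun b hb => ?_).symm
    refine P.indicator_fiber_of_ne (fun hxb => h ?_) _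
    rw [← P.res_q k x, hxb]
    exact (Finset.mem_filter.1 hb).2

/-- The indicator of a fibre at level `k` is the sum of the indicators of the fibres at level
`k + 1` over it (a finite DISJOINT union — the inverse-limit shape). -/
theorem indicatorCM_fiber_eq_sum (k : ℕ) (a : P.F k) :
    (indicatorCM (P.fiber k a) : C(X, A)) =
      ∑ b ∈ univ.filter (fun b : P.F (k + 1) => P.res k b = a), indicatorCM (P.fiber (k + 1) b) := by
  ext x
  simp only [ContinuousMap.coe_sum, Finset.sum_apply, indicatorCM_apply (P.isClopen_fiber _ _)]
  exact P.indicator_fiber_eq_sum_succ k a x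

open Classical in
/-- Pointwise form of the decomposition of a clopen set into the fibres of level `K` it contains. -/
theorem indicator_eq_sum_fiber_of_forall {U : Set X} {K : ℕ}
    (hK : ∀ x ∈ U, P.fiber K (P.q K x) ⊆ U) (x : X) :
    U.indicator (1 : X → A) x =
      ∑ a ∈ univ.filter (fun a : P.F K => P.fiber K a ⊆ U), (P.fiber K a).indicator (1 : X → A) x := by
  by_cases hx : x ∈ U
  · rw [Set.indicator_of_mem hx,
      Finset.sum_eq_single_of_mem (P.q K x) (Finset.mem_filter.2 ⟨Finset.mem_univ _, hK x hx⟩)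
        (fun b _ hb => P.indicator_fiber_of_ne (Ne.symm hb) _),
      Set.indicator_of_mem (P.mem_fiber_self K x)]
  · rw [Set.indicator_of_notMem hx]
    refine (Finset.sum_eq_zero fun a ha => ?_).symm
    refine P.indicator_fiber_of_ne (fun hxa => hx ?_) _
    have hsub : P.fiber K a ⊆ U := (Finset.mem_filter.1 ha).2
    exact hsub (hxa ▸ P.mem_fiber_self K x)

variable [CompactSpace X]

open Classical in
/-- Every clopen subset of `X` is a finite disjoint union of fibres of one level `K`: its
indicator is the sum of the indicators of the fibres it contains. -/
theorem indicatorCM_eq_sum_fiber {U : Set X} (hU : IsClopen U) :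
    ∃ K : ℕ, (indicatorCM U : C(X, A)) =
      ∑ a ∈ univ.filter (fun a : P.F K => P.fiber K a ⊆ U), indicatorCM (P.fiber K a) := by
  obtain ⟨K, hK⟩ := P.exists_level_fiber_subset hU
  refine ⟨K, ?_⟩
  ext x
  simp only [ContinuousMap.coe_sum, Finset.sum_apply, indicatorCM_apply hU,
    indicatorCM_apply (P.isClopen_fiber _ _)]
  exact P.indicator_eq_sum_fiber_of_forall hK x

end Indicator

section Coord

variable {A : Type*} [NormedCommRing A]

/-- The COORDINATES of a measure in `lim_k A[F k]`: `coord m k a := m(1_{fiber k a})`, the value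
of the measure on the coset of `U_k` attached to `a`. -/
noncomputable def coord (m : C(X, A) →ₗ[A] A) (k : ℕ) (a : P.F k) : A :=
  m (indicatorCM (P.fiber k a))

/-- `P.coord m k a = m(1_{P.fiber k a})`. -/
theorem coord_apply (m : C(X, A) →ₗ[A] A) (k : ℕ) (a : P.F k) :
    P.coord m k a = m (indicatorCM (P.fiber k a)) := rfl

/-- COMPATIBILITY (the inverse-limit condition): the coordinate at level `k` is the sum of the
coordinates at level `k + 1` over it — finite additivity of the measure. -/
theorem coord_compat (m : C(X, A) →ₗ[A] A) (k : ℕ) (a : P.F k) :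
    P.coord m k a = ∑ b ∈ univ.filter (fun b : P.F (k + 1) => P.res k b = a), P.coord m (k + 1) b := by
  simp only [coord_apply]
  rw [P.indicatorCM_fiber_eq_sum, map_sum]

variable [CompactSpace X]

/-- BOUNDEDNESS: `‖coord m k a‖ ≤ C` for a measure bounded by `C`. -/
theorem norm_coord_le [NormOneClass A] (m : C(X, A) →ₗ[A] A) {C : ℝ} (hC : 0 ≤ C)
    (hm : ∀ φ : C(X, A), ‖m φ‖ ≤ C * ‖φ‖) (k : ℕ) (a : P.F k) : ‖P.coord m k a‖ ≤ C :=
  (hm _).trans (mul_le_of_le_one_right hC (norm_indicatorCM_le _))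

end Coord

end Presentation

/-- A bounded `A`-valued DISTRIBUTION on a presented space: a compatible system of values on the
levels with a uniform bound — an element of `lim_k A[F k]` (`W[[Γ]] = lim_U W[Γ/U]` in print). -/
structure Distribution {X : Type u} [MetricSpace X] (P : Presentation.{u, v} X) (A : Type*)
    [NormedCommRing A] where
  /-- the value at `a : F k`. -/
  val : ∀ k : ℕ, P.F k → A
  /-- the inverse-limit condition. -/
  compat : ∀ (k : ℕ) (a : P.F k),
    val k a = ∑ b ∈ univ.filter (fun b : P.F (k + 1) => P.res k b = a), val (k + 1) b
  /-- a uniform bound. -/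
  bound : ℝ
  /-- `‖val k a‖ ≤ bound`. -/
  norm_le : ∀ (k : ℕ) (a : P.F k), ‖val k a‖ ≤ bound

namespace Presentation

variable {X : Type u} [MetricSpace X] (P : Presentation.{u, v} X)
variable {A : Type*} [NormedCommRing A] [CompactSpace X]

/-- The distribution (system of coordinates) of a bounded measure. -/
noncomputable def toDistribution [NormOneClass A] (m : C(X, A) →ₗ[A] A) {C : ℝ} (hC : 0 ≤ C)
    (hm : ∀ φ : C(X, A), ‖m φ‖ ≤ C * ‖φ‖) : Distribution P A where
  val := P.coord m
  compat := P.coord_compat m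
  bound := C
  norm_le := P.norm_coord_le m hC hm

/-- `(P.toDistribution m hC hm).val = P.coord m`. -/
@[simp] theorem toDistribution_val [NormOneClass A] (m : C(X, A) →ₗ[A] A) {C : ℝ} (hC : 0 ≤ C)
    (hm : ∀ φ : C(X, A), ‖m φ‖ ≤ C * ‖φ‖) : (P.toDistribution m hC hm).val = P.coord m := rfl

variable [T2Space X] [TotallyDisconnectedSpace X]

/-- A BOUNDED MEASURE IS ITS SYSTEM OF COORDINATES: two bounded functionals with the same
coordinates at every level coincide (every clopen indicator is a finite sum of fibre indicators,
and §59's `eq_of_forall_indicator`). -/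
theorem eq_of_coord_eq (m₁ m₂ : C(X, A) →ₗ[A] A) {C : ℝ} (hC : 0 ≤ C)
    (hm₁ : ∀ φ : C(X, A), ‖m₁ φ‖ ≤ C * ‖φ‖) (hm₂ : ∀ φ : C(X, A), ‖m₂ φ‖ ≤ C * ‖φ‖)
    (h : ∀ (k : ℕ) (a : P.F k), P.coord m₁ k a = P.coord m₂ k a) : m₁ = m₂ := by
  apply T5LocallyConstantDetermines.eq_of_forall_indicator m₁ m₂ hC hm₁ hm₂
  intro U hU
  obtain ⟨K, hK⟩ := P.indicatorCM_eq_sum_fiber (A := A) hU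
  rw [hK, map_sum, map_sum]
  exact Finset.sum_congr rfl fun a _ => h K a

/-- `toDistribution` is injective on measures bounded by a common `C`. -/
theorem toDistribution_injective [NormOneClass A] (m₁ m₂ : C(X, A) →ₗ[A] A) {C : ℝ}
    (hC : 0 ≤ C) (hm₁ : ∀ φ : C(X, A), ‖m₁ φ‖ ≤ C * ‖φ‖) (hm₂ : ∀ φ : C(X, A), ‖m₂ φ‖ ≤ C * ‖φ‖)
    (h : P.toDistribution m₁ hC hm₁ = P.toDistribution m₂ hC hm₂) : m₁ = m₂ :=
  P.eq_of_coord_eq m₁ m₂ hC hm₁ hm₂ fun k a => by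
    have := congrArg Distribution.val h
    exact congrFun (congrFun this k) a

/-- A measure with all coordinates zero is zero. -/
theorem eq_zero_of_forall_coord_eq_zero (m : C(X, A) →ₗ[A] A) {C : ℝ} (hC : 0 ≤ C)
    (hm : ∀ φ : C(X, A), ‖m φ‖ ≤ C * ‖φ‖) (h : ∀ (k : ℕ) (a : P.F k), P.coord m k a = 0) : m = 0 :=
  P.eq_of_coord_eq m 0 hC hm
    (fun φ => by
      simp only [LinearMap.zero_apply, norm_zero]
      exact mul_nonneg hC (norm_nonneg φ))
    (fun k a => by rw [h k a, coord_apply, LinearMap.zero_apply])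

end Presentation

section Mu

variable {X : Type u} [MetricSpace X] (P : Presentation.{u, v} X) [CompactSpace X]
variable {A : Type*} [NormedCommRing A] [IsDomain A] [IsDiscreteValuationRing A]

/-- THE μ-INVARIANT AS PRINTED, over the cofinal subgroups: «μ(φ) = inf over the cosets `U` of
the `U_k` of `v(φ(U))`» — `muV m = ⨅ k a, v(coord m k a)` (the fibres are clopen, and every
clopen indicator is a finite sum of fibre indicators, with `v(Σ) ≥ min v` by the ultrametric
property of `addVal`). -/
theorem Presentation.muV_eq_iInf_coord (m : C(X, A) →ₗ[A] A) :
    muV m = ⨅ k : ℕ, ⨅ a : P.F k, addVal A (P.coord m k a) := by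
  apply le_antisymm
  · exact le_iInf fun k => le_iInf fun a => muV_le m (P.isClopen_fiber k a)
  · unfold muV
    refine le_iInf fun U => ?_
    obtain ⟨K, hK⟩ := P.indicatorCM_eq_sum_fiber (A := A) U.2
    rw [hK, map_sum]
    exact AddValuation.map_le_sum _ fun a _ =>
      (iInf_le (fun k : ℕ => ⨅ a : P.F k, addVal A (P.coord m k a)) K).trans
        (iInf_le (fun a : P.F K => addVal A (P.coord m K a)) a)

/-- `n ≤ μ(m)` iff every coordinate has valuation `≥ n`. -/
theorem Presentation.natCast_le_muV_iff_forall_coord (m : C(X, A) →ₗ[A] A) (n : ℕ) :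
    (n : ℕ∞) ≤ muV m ↔ ∀ (k : ℕ) (a : P.F k), (n : ℕ∞) ≤ addVal A (P.coord m k a) := by
  rw [P.muV_eq_iInf_coord]
  simp only [le_iInf_iff]

end Mu

end Summit.Ventures.HodgeRepro2.T5ProfiniteDistribution
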